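import Summits.QuantumFields.YangMills.Theorems.F4SubCurvatureDoorShortRootRigiditySliceDensity
import Summits.QuantumFields.YangMills.Theorems.F4SubCurvatureDoorPlanarLFFourierMeasure
import Summits.QuantumFields.YangMills.Theorems.F4SubCurvatureDoorTwoMirrorCore
import Mathlib
import HarnessLib

/-!
# Transverse slice — the by-name rungs `TwoMirrorLFConstancy` and `HexagonalLFConstancy` (LINE g19-A, ⟨stmt-QuantumFields-23035⟩)

LINE g19-A «transverse slice» on crux ⟨stmt-QuantumFields-23035⟩ `F4SubCurvatureDoor.ShortRootRigidity`; rung file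
`Cruxes/ShortRootRigidity/Lines/transverse_slice_rung_bounded.lean` (ns `…Cruxes.ShortRootRigidity.TransverseSlice.BoundedRung`,
first rung of the heart `stub_planarRigidity`, the BOUNDED sub-claim).  This file restates the rung's problem-side definitions
`rot`, `lf`, `TwoMirrorLFConstancy`, `HexagonalLFConstancy` and the certified glue `hexagonal_of_twoMirror` CHARACTER-IDENTICALLY
(the plane `E2` is the tree's `…F4SubCurvatureDoorSliceDensityRegistered.E2`, as in the skeleton's registered stubs) and PROVES

* `twoMirrorLFConstancy : TwoMirrorLFConstancy` — ENGINE «TWO NON-PERPENDICULAR RP MIRRORS»: the planar Laplace–Fourier transform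
  `k(y) = ∫ e^{-E|y₀|} cos(p y₁) dμ(E,p)` of a FINITE positive measure carried by `E ≥ 0` which is invariant under a rotation by an
  angle `α` with `cos α ≠ 0`, `sin α ≠ 0` is constant;
* `hexagonalLFConstancy : HexagonalLFConstancy` — the case `α = π/3` (via the glue).

PROOF (measure level; no densities, no disintegration).  `k` is even in `y₀` and in `y₁` separately and `rot(-α) = rot(α)⁻¹`, so
WLOG `c = |cos α| > 0`, `s = |sin α| > 0` (`lf_plane_const`).  By `…PlanarLFFourierMeasure.exists_planarFourierMeasure`, `2k` is the
characteristic function of the FINITE planar measure `ν = law of (Eξ, ±p)` under `μ ⊗ Cauchy(dξ)`, which therefore inherits the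
rotation invariance (Mathlib's `Measure.ext_of_charFunDual`) and is computed on planar sets by the frame formula
`ν(A) = ∫[C{ξ:(Eξ,p)∈A} + C{ξ:(Eξ,-p)∈A}]dμ`; by `…TwoMirrorCore.measure_pos_energy_eq_zero` (the scale-free monotonicity of the
Cauchy kernel applied once along the rotated fibres and once along the horizontal fibres, against `ν{|q₁| ≥ n} → 0`) this forces
`μ{E > 0} = 0`, whence `k(t, x) = φ(x) := ∫cos(px)dμ` with `φ(st + cx) = φ(x)`, i.e. `φ` is constant.  Sharp at `α = π/2`
(`e^{-|y₀|} + e^{-|y₁|}`, the rung file's witness): the rotated-fibre step needs `cos α ≠ 0` and the horizontal step needs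
`sin α ≠ 0`.

HONEST LABEL: a rung strictly inside the BOUNDED toy case of the heart `stub_planarRigidity` of an OPEN line; nothing about the
singular case of `PlanarRigidity`, `BoundedPlanarConstancy` (the Berg–Christensen–Ressel step), C3, ⟨23035⟩, ⟨23125⟩, R2d or any
summit is proved by this file; the Yang–Mills mass gap is NOT proved; no summit is proved by a line.
-/

noncomputable section

open MeasureTheory Filter Topology
open scoped BigOperators

namespace Summit.QuantumFields.YangMills.Theorems.F4SubCurvatureDoorTwoMirrorLFConstancyRegistered

open Summit.QuantumFields.YangMills.Theorems.F4SubCurvatureDoorSliceDensityRegistered (E2)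
open Summit.QuantumFields.YangMills.Theorems.F4SubCurvatureDoorPlanarLFFourierMeasure
open Summit.QuantumFields.YangMills.Theorems.F4SubCurvatureDoorTwoMirrorCore

/-- Rotation of the plane by the angle `α`. [problem-side definition] -/
def rot (α : ℝ) (y : E2) : E2 :=
  (WithLp.equiv 2 (Fin 2 → ℝ)).symm ![Real.cos α * y 0 - Real.sin α * y 1, Real.sin α * y 0 + Real.cos α * y 1]

/-- The planar Laplace–Fourier transform of a measure `μ` on `(E, p) ∈ ℝ × ℝ` along the mirror normal `e₀`. [problem-side definition] -/
def lf (μ : Measure (ℝ × ℝ)) (y : E2) : ℝ :=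
  ∫ z, Real.exp (-(z.1 * |y 0|)) * Real.cos (z.2 * y 1) ∂μ

/-- ENGINE «TWO NON-PERPENDICULAR RP MIRRORS»: the LF transform of a finite positive measure supported in `E ≥ 0` which is invariant under a
rotation by `α` with `cos α ≠ 0`, `sin α ≠ 0` is constant (equivalently `μ = μ(univ)·δ₀`).  Sharp at `α = π/2`. -/
def TwoMirrorLFConstancy : Prop :=
  ∀ α : ℝ, Real.cos α ≠ 0 → Real.sin α ≠ 0 →
    ∀ μ : Measure (ℝ × ℝ), IsFiniteMeasure μ → μ {z | z.1 < 0} = 0 →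
      (∀ y : E2, lf μ (rot α y) = lf μ y) → ∀ y : E2, lf μ y = lf μ 0

/-- The hexagonal case `α = π/3` of the engine (what the D₆ symmetry of a bounded planar-class kernel supplies). -/
def HexagonalLFConstancy : Prop :=
  ∀ μ : Measure (ℝ × ℝ), IsFiniteMeasure μ → μ {z | z.1 < 0} = 0 →
    (∀ y : E2, lf μ (rot (Real.pi / 3) y) = lf μ y) → ∀ y : E2, lf μ y = lf μ 0

/-- Certified glue: the engine gives the hexagonal case (`cos(π/3) = 1/2`, `sin(π/3) = √3/2`). -/
theorem hexagonal_of_twoMirror (h : TwoMirrorLFConstancy) : HexagonalLFConstancy := by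
  intro μ hfin hsupp hinv
  have hc : Real.cos (Real.pi / 3) ≠ 0 := by rw [Real.cos_pi_div_three]; norm_num
  have hs : Real.sin (Real.pi / 3) ≠ 0 := by
    rw [Real.sin_pi_div_three]; positivity
  exact h (Real.pi / 3) hc hs μ hfin hsupp hinv

/-! ## The engine in coordinates -/

/-- **The engine in plane coordinates, for `c, s > 0`, `c² + s² = 1`.**  If the planar Laplace–Fourier transform
`k(t, x) = ∫ e^{-E|t|} cos(p x) dμ` of a finite measure with `μ{E < 0} = 0` satisfies `k(ct - sx, st + cx) = k(t, x)`, then `k`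
is constant. -/
theorem lf_plane_const (μ : Measure (ℝ × ℝ)) [IsFiniteMeasure μ] (hsupp : μ {z | z.1 < 0} = 0)
    {c s : ℝ} (hc : 0 < c) (hs : 0 < s) (hcs : c ^ 2 + s ^ 2 = 1)
    (hk : ∀ t x : ℝ,
      ∫ z, Real.exp (-(z.1 * |c * t - s * x|)) * Real.cos (z.2 * (s * t + c * x)) ∂μ
        = ∫ z, Real.exp (-(z.1 * |t|)) * Real.cos (z.2 * x) ∂μ)
    (t x : ℝ) :
    ∫ z, Real.exp (-(z.1 * |t|)) * Real.cos (z.2 * x) ∂μ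
      = ∫ z, Real.exp (-(z.1 * |(0 : ℝ)|)) * Real.cos (z.2 * (0 : ℝ)) ∂μ := by
  obtain ⟨ν, hνfin, hνF, hνR⟩ := exists_planarFourierMeasure μ hsupp hk
  haveI := hνfin
  have hae : ∀ᵐ z ∂μ, 0 ≤ z.1 := by
    rw [ae_iff]
    simpa [not_le] using hsupp
  have hpos := measure_pos_energy_eq_zero μ hae hc hs hcs ν hνF hνR
  have hae' : ∀ᵐ z ∂μ, ¬ 0 < z.1 := by
    rw [ae_iff]
    simpa using hpos
  have hzero : ∀ᵐ z ∂μ, z.1 = 0 := by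
    filter_upwards [hae, hae'] with z h1 h2
    exact le_antisymm (not_lt.1 h2) h1
  -- `k(t, x) = φ(x)`
  have hk0 : ∀ t x : ℝ, ∫ z, Real.exp (-(z.1 * |t|)) * Real.cos (z.2 * x) ∂μ = ∫ z, Real.cos (z.2 * x) ∂μ := by
    intro t x
    refine integral_congr_ae ?_
    filter_upwards [hzero] with z hz
    rw [hz, zero_mul, neg_zero, Real.exp_zero, one_mul]
  -- `φ(st + cx) = φ(x)`, hence `φ(x) = φ(0)`
  have hφ : ∫ z, Real.cos (z.2 * x) ∂μ = ∫ z, Real.cos (z.2 * 0) ∂μ := by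
    have h := hk (x / s) 0
    rw [hk0, hk0] at h
    have e : s * (x / s) + c * 0 = x := by
      rw [mul_zero, add_zero]
      field_simp
    rw [e] at h
    exact h
  rw [hk0, hk0, hφ]

/-! ## The rungs -/

/-- **RUNG R1′ (by name): `TwoMirrorLFConstancy`.** -/
theorem twoMirrorLFConstancy : TwoMirrorLFConstancy := by
  intro α hcos hsin μ hfin hsupp hinv y
  haveI := hfin
  -- coordinates of `rot`
  have hrot0 : ∀ y : E2, rot α y 0 = Real.cos α * y 0 - Real.sin α * y 1 := fun y => by
    simp [rot]
  have hrot1 : ∀ y : E2, rot α y 1 = Real.sin α * y 0 + Real.cos α * y 1 := fun y => by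
    simp [rot]
  -- the transform in coordinates
  set k : ℝ → ℝ → ℝ := fun t x => ∫ z, Real.exp (-(z.1 * |t|)) * Real.cos (z.2 * x) ∂μ with hk_def
  have hlf : ∀ y : E2, lf μ y = k (y 0) (y 1) := fun y => rfl
  have hH : ∀ t x : ℝ, k (Real.cos α * t - Real.sin α * x) (Real.sin α * t + Real.cos α * x) = k t x := by
    intro t x
    have h := hinv ((WithLp.equiv 2 (Fin 2 → ℝ)).symm ![t, x])
    rw [hlf, hlf, hrot0, hrot1] at h
    simpa using h
  -- evenness in each variable
  have heven1 : ∀ t x : ℝ, k (-t) x = k t x := by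
    intro t x
    simp only [hk_def, abs_neg]
  have heven2 : ∀ t x : ℝ, k t (-x) = k t x := by
    intro t x
    simp only [hk_def, mul_neg, Real.cos_neg]
  -- invariance under the inverse rotation
  have hHinv : ∀ t x : ℝ, k (Real.cos α * t + Real.sin α * x) (-Real.sin α * t + Real.cos α * x) = k t x := by
    intro t x
    have h := hH (Real.cos α * t + Real.sin α * x) (-Real.sin α * t + Real.cos α * x)
    have e1 : Real.cos α * (Real.cos α * t + Real.sin α * x) - Real.sin α * (-Real.sin α * t + Real.cos α * x) = t := by
      linear_combination t * Real.cos_sq_add_sin_sq α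
    have e2 : Real.sin α * (Real.cos α * t + Real.sin α * x) + Real.cos α * (-Real.sin α * t + Real.cos α * x) = x := by
      linear_combination x * Real.cos_sq_add_sin_sq α
    rw [e1, e2] at h
    exact h.symm
  -- WLOG `c = |cos α| > 0`, `s = |sin α| > 0`
  set c := |Real.cos α| with hc_def
  set s := |Real.sin α| with hs_def
  have hc : 0 < c := abs_pos.2 hcos
  have hs : 0 < s := abs_pos.2 hsin
  have hcs : c ^ 2 + s ^ 2 = 1 := by
    rw [hc_def, hs_def, sq_abs, sq_abs]
    exact Real.cos_sq_add_sin_sq α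
  have hk : ∀ t x : ℝ, k (c * t - s * x) (s * t + c * x) = k t x := by
    intro t x
    rcases lt_or_gt_of_ne hcos with h1 | h1 <;> rcases lt_or_gt_of_ne hsin with h2 | h2
    · -- cos α < 0, sin α < 0
      rw [hc_def, hs_def, abs_of_neg h1, abs_of_neg h2,
        show -Real.cos α * t - -Real.sin α * x = -(Real.cos α * t - Real.sin α * x) by ring,
        show -Real.sin α * t + -Real.cos α * x = -(Real.sin α * t + Real.cos α * x) by ring, heven1, heven2]
      exact hH t x
    · -- cos α < 0, sin α > 0
      rw [hc_def, hs_def, abs_of_neg h1, abs_of_pos h2,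
        show -Real.cos α * t - Real.sin α * x = -(Real.cos α * t + Real.sin α * x) by ring,
        show Real.sin α * t + -Real.cos α * x = -(-Real.sin α * t + Real.cos α * x) by ring, heven1, heven2]
      exact hHinv t x
    · -- cos α > 0, sin α < 0
      rw [hc_def, hs_def, abs_of_pos h1, abs_of_neg h2,
        show Real.cos α * t - -Real.sin α * x = Real.cos α * t + Real.sin α * x by ring,
        show -Real.sin α * t + Real.cos α * x = -Real.sin α * t + Real.cos α * x by ring]
      exact hHinv t x
    · -- cos α > 0, sin α > 0
      rw [hc_def, hs_def, abs_of_pos h1, abs_of_pos h2]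
      exact hH t x
  -- the engine in coordinates
  have hmain := lf_plane_const μ hsupp hc hs hcs hk (y 0) (y 1)
  rw [hlf, hlf]
  have h0 : (0 : E2) 0 = 0 := rfl
  have h1 : (0 : E2) 1 = 0 := rfl
  rw [h0, h1]
  exact hmain

/-- **RUNG R1 (by name): `HexagonalLFConstancy`.** -/
theorem hexagonalLFConstancy : HexagonalLFConstancy :=
  hexagonal_of_twoMirror twoMirrorLFConstancy

end Summit.QuantumFields.YangMills.Theorems.F4SubCurvatureDoorTwoMirrorLFConstancyRegistered

end
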